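import Summits.HubbardSuperconductivity.HubbardLadder.Bounds.StiffnessFromEnergyBrackets
import Literature.MathematicalPhysics.QuantumLattice.HubbardTorusFluxStiffnessResponse
import Literature.MathematicalPhysics.QuantumLattice.InfVolFermionStateCompactness
import Literature.MathematicalPhysics.QuantumLattice.HubbardNNNHoppingTorusLimitCorrelator
import Literature.MathematicalPhysics.QuantumLattice.HubbardKineticEnergyDensity
import Literature.MathematicalPhysics.QuantumLattice.InfVolFermionStateHubbardEnergy
import Literature.MathematicalPhysics.QuantumLattice.HubbardCorrelatorCertificate
import HarnessLib

/-!
# Ventures/CertifiedManyBodySolver — Observables/KineticCeilingStiffnessTL.lean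

HONEST FRAMING: first certified bounds on pairing observables; not a superconductivity verdict; every number certified or
labelled float. (hubbard-obs cell, D-0042; obs-lit seat g2 taking hubbard-obs-p2's open item T6 = the "TL tower" of the f-sum
stiffness ceiling, STIFFNESS-SDP.md T1/T6(a); theorem-only, zero compute, no certificate, no definition, no named fact, no `sorry`.)

**The f-sum (Scalapino–White–Zhang) stiffness ceiling in the thermodynamic limit, from a kinetic-energy ceiling that holds for
EVERY torus-limit ground state.** Square lattice, `t = 1`, `t′ = 0`, `U ≥ 0`, hole doping `δ ∈ (−1, 1]` (density `n = 1 − δ`):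

* `kineticDensity_eq_energyDensityTT'_sub_mul_docc` — the DICTIONARY: for every torus limit `ω` of unit `(rectN n L, S^z = 0)`-sector
  ground states of `hubbardTorusTT' L 1 0 U`, the kinetic energy density (bond form, both directions, both spins)
  `k(ω) := Σ_{i=1,2} (−1)·Σ_σ (Re ω(c†_{0σ}c_{e_iσ}) + Re ω(c†_{e_iσ}c_{0σ}))` equals `e(U, n) − U·Re ω(n_{0↑}n_{0↓})`,
  `e = energyDensityTT' 1 0 U n` (Bratteli–Robinson II §6.2.4; `IsTorusLimitOf.hubbardEnergyDensity_eq_energyDensity2D` +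
  `IsTranslationInvariant.hubbardEnergyDensity_eq_docc_add_hopping`); the `U = 8`, `n = 7/8` instance is
  `Certificates.m3_tp0_kineticDensity_eq_energy_sub_docc`.
* `fluxStiffness_le_quarter_of_forall_torusLimit_negKinetic_le` — **T6**: if `−k(ω) ≤ X` for EVERY such torus limit `ω` (along every
  `Ls → ∞`), then every flux stiffness of the class obeys `ρ_s ≤ X/4`: precisely, for all `ρ_s, θ₀ > 0` and `L₀`, if
  `ρ_s θ² ≤ E_L(θ) − E_L(0)` (`fluxEnergy L U δ`) for `|θ| ≤ θ₀` and all even `L ≥ L₀`, then `ρ_s ≤ X/4` — the trailing-binder shape of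
  hubbard-obs-p2's chord row `m3_tp0_fluxStiffness_le_chordSharp_r354_r426` and of pub-hubbard's `stiffness_le_of_energyDensityBrackets(_sharp)`.
  PROOF (the tower): (1) FINITE `L` (all PROVED in the tree): for a unit sector ground state `ψ` and its rotation `φ = Γ(r)ψ` (again a unit
  sector ground state, `IsGroundStateInSector.fockMapOp_d4Orb_mulVec`), the f-sum floor `ρ_s L² ≤ K_x` (`stiffness_mul_sq_le_sum_re_hop_of_isGroundStateInSector`,
  HubbardTorusFluxStiffnessResponse.lean) applied to `ψ` and to `φ` with `K_y(φ) = K_x(ψ)` (`kinWeightDir_one_rot`) gives `4ρ_s L² ≤ 2(K_x + K_y)(φ) = ⟨−T⟩_φ =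
  U·D(φ) − ⟨φ, H(1,U) φ⟩` (`re_expect_hubbardTorus_eq_kin`, pub-hubbard StiffnessFromEnergyBrackets.lean — the argument of
  `stiffnessCeilingFromEnergyBrackets_holds`, verbatim); (2) COMPACTNESS: along the even sizes the rotated ground states have a torus-limit
  point `ω` on a subsequence (`InfVolFermionState.exists_isTorusLimitOf_subseq_of_isNParticle`, Banach–Alaoglu, Bratteli–Robinson I Thm 2.3.15);
  (3) CONVERGENCE along it: `⟨φ_L, H φ_L⟩/L² → e(U, n)` (Ruelle, `tendsto_energyDensity2D_torus`) and `D(φ_L)/L² → Re ω(n_{0↑}n_{0↓})` (the torus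
  average of the local double occupancy, `torusAvgExpect_docc`, IS the total double occupancy per site), so `⟨−T⟩_{φ_L}/L² → U·docc(ω) − e = −k(ω)`
  by the dictionary; (4) `4ρ_s ≤ −k(ω) ≤ X`.
* M3′ wrapper `m3_tp0_fluxStiffness_le_quarter_of_forall_negKinetic_le` (`U = 8`, `n = 7/8`, `δ = 1/8`).
CONSEQUENCES (no new number here): (i) the registry row `OBS.rhosK.tp0.TLderived` (ρ_s ≤ 15746217922602363028802719/2⁸⁵ ≈ 0.4070302, obs-ref V2
PASS-AS-CONDITIONAL on exactly this T6) becomes UNCONDITIONAL by feeding `m3_tp0_kineticDensity_ge_derived h473 h261 h166`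
(Certificates/HubbardSquare_n7o8_kinetic_tp0_derived_r473_r261.lean) — still DOMINATED by the one-body half-bathtub 0.40194 and by the chord 0.3748013;
(ii) every future certified KINETIC CEILING of the class (the rung-0b `kinlo` edge on EXT5-L⁺, hubbard-lower l2-eng-2's menu; lead RULING (z1)/(aa2):
pre-registered −k^up ∈ [1.20, 1.40]) converts at once into a certified STIFFNESS ceiling `ρ_s ≤ −k^up/4` (HVR `½(D_s^x+D_s^y) ≤ −k^up/8`) that would
displace the chord rows of record. PRIOR ART BY NAME: the finite-torus f-sum floor and the energy-bracket route are pub-hubbard BOUNDS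
(StiffnessCeilingsProofs / StiffnessFromEnergyBrackets{,Sharp,TL}.lean, bounds.tex Thm 3/3♯; Scalapino–White–Zhang 1993 §II; Hazra–Verma–Randeria 2019
eq. (2)); NEW here is only the torus-limit-STATE form of the hypothesis (what an SDP certificate on the TL state class delivers) and its compactness
passage. Units: tree `ρ_s` (`E(θ) − E(0) ≈ ρ_s θ²`); HVR `D_s = ρ_s/2`; SWZ `D/(πe²) = 2ρ_s` (hubbard-obs-p2 convention sentence).
-/

noncomputable section

namespace Summit.Ventures.CertifiedManyBodySolver.Observables

open Literature.MathematicalPhysics.QuantumLattice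
open Literature.MathematicalPhysics.QuantumLattice.ThermodynamicLimit
open Literature.MathematicalPhysics.QuantumFieldTheory
open Literature.Probability.LatticeModels
open Summit.HubbardSuperconductivity.HubbardLadder.Bounds
open Matrix Finset Filter Topology HubbardWave0
open scoped Matrix BigOperators ComplexOrder

/-! ## §1 The dictionary `k(ω) = e(U,n) − U·docc(ω)` for torus-limit ground states at `t′ = 0` -/

/-- **The kinetic energy density of a torus-limit ground state is `e₀ − U·docc`** (`t = 1`, `t′ = 0`, `U ≥ 0`, `0 ≤ n < 2`): for every
torus limit `ω` of unit `(rectN n L, S^z = 0)`-sector ground states of `hubbardTorusTT' L 1 0 U` (= `hubbardTorus 2 L 1 U`, `hubbardTorusTT'_zero`),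
`Σ_i (−1)Σ_σ(Re ω(c†_0c_{e_i}) + Re ω(c†_{e_i}c_0)) = energyDensityTT' 1 0 U n − U·Re ω(n_{0↑}n_{0↓})`
(`IsTorusLimitOf.hubbardEnergyDensity_eq_energyDensity2D`, `IsTranslationInvariant.hubbardEnergyDensity_eq_docc_add_hopping`, `energyDensityTT'_zero`).
[cite: BratteliRobinsonII1997, §6.2.4] -/
theorem kineticDensity_eq_energyDensityTT'_sub_mul_docc {U : ℝ} (hU : 0 ≤ U) {n : ℝ} (hn0 : 0 ≤ n) (hn2 : n < 2)
    (ω : InfVolFermionState 2) (Ls : ℕ → ℕ) (ψ : ∀ L, Fock (Orb (FermionTorus 2 L)))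
    (hLs : Tendsto Ls atTop atTop)
    (hψ : ∀ j, IsGroundStateInSector (hubbardTorusTT' (Ls j) 1 0 U) (rectN n (Ls j)) 0 (ψ (Ls j)))
    (hψ1 : ∀ j, star (ψ (Ls j)) ⬝ᵥ ψ (Ls j) = 1) (hω : ω.IsTorusLimitOf ψ Ls) :
    (∑ i : Fin 2, -(1 : ℝ) * ∑ σ : Fin 2,
        ((ω.expect {0, 0 + unitVec i}
            ((cAt 0 (mem_insert_self _ _) σ)ᴴ * cAt (0 + unitVec i) (mem_insert_of_mem (mem_singleton_self _)) σ)).re +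
          (ω.expect {0, 0 + unitVec i}
            ((cAt (0 + unitVec i) (mem_insert_of_mem (mem_singleton_self _)) σ)ᴴ * cAt 0 (mem_insert_self _ _) σ)).re)) =
      energyDensityTT' 1 0 U n -
        U * (ω.expect ({0} : Finset (Site 2)) (nAt 0 (mem_singleton_self 0) 0 * nAt 0 (mem_singleton_self 0) 1)).re := by
  have hψ' : ∀ j, IsGroundStateInSector (hubbardTorus 2 (Ls j) 1 U) (rectN n (Ls j)) 0 (ψ (Ls j)) := fun j => by
    simpa only [hubbardTorusTT'_zero] using hψ j
  have he : ω.hubbardEnergyDensity 1 U = energyDensity2D 1 U n :=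
    hω.hubbardEnergyDensity_eq_energyDensity2D 1 hLs hU hn0 hn2 hψ' hψ1
  have hsplit := hω.isTranslationInvariant.hubbardEnergyDensity_eq_docc_add_hopping 1 U
  rw [energyDensityTT'_zero, ← he, hsplit]
  ring

/-! ## §2 Finite `L`: `4ρ_s L² ≤ ⟨−T⟩_φ = U·D(φ) − ⟨φ, H φ⟩` for the ROTATED unit sector ground state -/

/-- **f-sum floor, both directions** (the argument of pub-hubbard's `stiffnessCeilingFromEnergyBrackets_holds`, kept at the level of one
ground state): `L ≥ 3`, `δ ≥ −1`, a flux stiffness `ρ_s > 0` at scale `θ₀ > 0` of the `(N_L, 0)` sector of `hubbardTorus 2 L 1 U`, and a unit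
sector ground state `ψ`; then the ROTATED ground state `φ = Γ(r)ψ` satisfies
`4ρ_s L² ≤ U·D(φ) − Re⟨φ, H(1,U) φ⟩` (`= 2(K_x + K_y)(φ) = ⟨−T⟩_φ`, `re_expect_hubbardTorus_eq_kin`).
[cite: ScalapinoWhiteZhang1993, §II] -/
theorem four_mul_stiffness_mul_sq_le_negKinetic_rot {L : ℕ} [NeZero L] (hL : 3 ≤ L) {U δ ρs θ₀ : ℝ}
    (hρs : 0 < ρs) (hθ₀ : 0 < θ₀)
    (hst : ∀ θ : ℝ, |θ| ≤ θ₀ → ρs * θ ^ 2 ≤ fluxEnergy L U δ θ - fluxEnergy L U δ 0)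
    {ψ : Fock (Orb (FermionTorus 2 L))}
    (hgs : IsGroundStateInSector (hubbardTorus 2 L 1 U) (2 * ⌊(1 - δ) * (L : ℝ) ^ 2 / 2⌋₊) 0 ψ) (h1 : star ψ ⬝ᵥ ψ = 1) :
    4 * (ρs * (L : ℝ) ^ 2) ≤
      U * (star (fockMapOp (d4Orb (DihedralGroup.r 1 : DihedralGroup 4)) *ᵥ ψ) ⬝ᵥ
            ((∑ x : FermionTorus 2 L, numberOp x 0 * numberOp x 1) *ᵥ
              (fockMapOp (d4Orb (DihedralGroup.r 1 : DihedralGroup 4)) *ᵥ ψ))).re -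
        (star (fockMapOp (d4Orb (DihedralGroup.r 1 : DihedralGroup 4)) *ᵥ ψ) ⬝ᵥ
            (hubbardTorus 2 L 1 U *ᵥ (fockMapOp (d4Orb (DihedralGroup.r 1 : DihedralGroup 4)) *ᵥ ψ))).re := by
  set φ : Fock (Orb (FermionTorus 2 L)) := fockMapOp (d4Orb (DihedralGroup.r 1 : DihedralGroup 4)) *ᵥ ψ with hφ_def
  have hφgs : IsGroundStateInSector (hubbardTorus 2 L 1 U) (2 * ⌊(1 - δ) * (L : ℝ) ^ 2 / 2⌋₊) 0 φ :=
    hgs.fockMapOp_d4Orb_mulVec _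
  have hφ1 : star φ ⬝ᵥ φ = 1 := by
    rw [hφ_def, star_fockMapOp_mulVec_dotProduct_self _ (d4Orb_bijective _).injective, h1]
  have hKy : kinWeightDir 1 φ = kinWeightDir 0 ψ := kinWeightDir_one_rot ψ
  have hfψ : ρs * (L : ℝ) ^ 2 ≤ kinWeightDir 0 ψ :=
    (stiffness_mul_sq_le_sum_re_hop_of_isGroundStateInSector hL U δ hρs hθ₀ hst hgs h1).trans_eq
      (kinWeightX_eq_kinWeightDir ψ)
  have hfφ : ρs * (L : ℝ) ^ 2 ≤ kinWeightDir 0 φ :=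
    (stiffness_mul_sq_le_sum_re_hop_of_isGroundStateInSector hL U δ hρs hθ₀ hst hφgs hφ1).trans_eq
      (kinWeightX_eq_kinWeightDir φ)
  have hkin := re_expect_hubbardTorus_eq_kin hL U φ
  have hD : doubleOccExp φ = (star φ ⬝ᵥ ((∑ x : FermionTorus 2 L, numberOp x 0 * numberOp x 1) *ᵥ φ)).re := rfl
  rw [hD, hKy] at hkin
  linarith

/-! ## §3 The thermodynamic-limit tower (compactness + convergence) -/

/-- **T6 — the f-sum stiffness ceiling in the thermodynamic limit from a kinetic ceiling on EVERY torus-limit ground state.**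
`U ≥ 0`, `−1 < δ ≤ 1`, `X : ℝ`. If every torus limit `ω` (along every `Ls → ∞`) of unit `(rectN (1 − δ) L, S^z = 0)`-sector ground states of
`hubbardTorusTT' L 1 0 U` satisfies `−k(ω) ≤ X` (`k` the bond-form kinetic energy density of §1), then every flux stiffness `ρ_s > 0` (scale
`θ₀ > 0`, all even `L ≥ L₀`) of the zero-flux `(N_L, 0)` sectors of `hubbardTorus 2 L 1 U` obeys `ρ_s ≤ X/4`.
[cite: ScalapinoWhiteZhang1993, §II] -/
theorem fluxStiffness_le_quarter_of_forall_torusLimit_negKinetic_le {U δ X : ℝ} (hU : 0 ≤ U) (hδ1 : -1 < δ) (hδ2 : δ ≤ 1)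
    (hX : ∀ (ω : InfVolFermionState 2) (Ls : ℕ → ℕ) (ψ : ∀ L, Fock (Orb (FermionTorus 2 L))),
      Tendsto Ls atTop atTop →
      (∀ j, IsGroundStateInSector (hubbardTorusTT' (Ls j) 1 0 U) (rectN (1 - δ) (Ls j)) 0 (ψ (Ls j))) →
      (∀ j, star (ψ (Ls j)) ⬝ᵥ ψ (Ls j) = 1) → ω.IsTorusLimitOf ψ Ls →
      -(∑ i : Fin 2, -(1 : ℝ) * ∑ σ : Fin 2,
          ((ω.expect {0, 0 + unitVec i}
              ((cAt 0 (mem_insert_self _ _) σ)ᴴ * cAt (0 + unitVec i) (mem_insert_of_mem (mem_singleton_self _)) σ)).re +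
            (ω.expect {0, 0 + unitVec i}
              ((cAt (0 + unitVec i) (mem_insert_of_mem (mem_singleton_self _)) σ)ᴴ * cAt 0 (mem_insert_self _ _) σ)).re)) ≤ X) :
    ∀ (ρs θ₀ : ℝ), 0 < ρs → 0 < θ₀ → ∀ L₀ : ℕ,
      (∀ (L : ℕ) [NeZero L], L₀ ≤ L → Even L →
        ∀ θ : ℝ, |θ| ≤ θ₀ → ρs * θ ^ 2 ≤ fluxEnergy L U δ θ - fluxEnergy L U δ 0) →
      ρs ≤ X / 4 := by
  intro ρs θ₀ hρs hθ₀ L₀ hst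
  have hn0 : (0 : ℝ) ≤ 1 - δ := by linarith
  have hn2 : (1 : ℝ) - δ < 2 := by linarith
  -- unit sector ground states at every size
  choose ψ hψ hψ1 using fun L => exists_unit_isGroundStateInSector_hubbardTorusTT' L 1 0 U hn0 hn2.le
  have hψH : ∀ L, IsGroundStateInSector (hubbardTorus 2 L 1 U) (rectN (1 - δ) L) 0 (ψ L) := fun L => by
    simpa only [hubbardTorusTT'_zero] using hψ L
  -- at every size `L ≥ 3` replace `ψ_L` by its rotation `Γ(r)ψ_L`, which carries the two-direction f-sum bound
  have hex : ∀ L : ℕ, ∃ Φ : Fock (Orb (FermionTorus 2 L)),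
      IsGroundStateInSector (hubbardTorus 2 L 1 U) (rectN (1 - δ) L) 0 Φ ∧ star Φ ⬝ᵥ Φ = 1 ∧
        (3 ≤ L → ∀ [NeZero L], L₀ ≤ L → Even L →
          4 * (ρs * (L : ℝ) ^ 2) ≤
            U * (star Φ ⬝ᵥ ((∑ x : FermionTorus 2 L, numberOp x 0 * numberOp x 1) *ᵥ Φ)).re -
              (star Φ ⬝ᵥ (hubbardTorus 2 L 1 U *ᵥ Φ)).re) := by
    intro L
    by_cases hL3 : 3 ≤ L
    · haveI : NeZero L := ⟨by omega⟩
      refine ⟨fockMapOp (d4Orb (DihedralGroup.r 1 : DihedralGroup 4)) *ᵥ ψ L, (hψH L).fockMapOp_d4Orb_mulVec _,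
        by rw [star_fockMapOp_mulVec_dotProduct_self _ (d4Orb_bijective _).injective, hψ1 L], fun _ _ hL₀ hev => ?_⟩
      exact four_mul_stiffness_mul_sq_le_negKinetic_rot hL3 hρs hθ₀ (hst L hL₀ hev) (hψH L) (hψ1 L)
    · exact ⟨ψ L, hψH L, hψ1 L, fun h => absurd h hL3⟩
  choose Φ hΦH hΦ1 hΦfs using hex
  have hΦ : ∀ L, IsGroundStateInSector (hubbardTorusTT' L 1 0 U) (rectN (1 - δ) L) 0 (Φ L) := fun L => by
    simpa only [hubbardTorusTT'_zero] using hΦH L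
  -- the even sizes `Ls m = 2 (m + M₀)`, `M₀ = max L₀ 3`
  set Ls : ℕ → ℕ := fun m => 2 * (m + max L₀ 3) with hLs_def
  have hLs : Tendsto Ls atTop atTop :=
    tendsto_atTop_mono (fun m : ℕ => (by simp only [hLs_def]; omega : m ≤ Ls m)) tendsto_id
  have hfin : ∀ m : ℕ, 4 * ρs ≤
      U * ((star (Φ (Ls m)) ⬝ᵥ ((∑ x : FermionTorus 2 (Ls m), numberOp x 0 * numberOp x 1) *ᵥ Φ (Ls m))).re /
          ((Ls m : ℕ) : ℝ) ^ 2) -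
        (star (Φ (Ls m)) ⬝ᵥ (hubbardTorus 2 (Ls m) 1 U *ᵥ Φ (Ls m))).re / ((Ls m : ℕ) : ℝ) ^ 2 := by
    intro m
    haveI : NeZero (Ls m) := ⟨by simp only [hLs_def]; omega⟩
    have hL3 : 3 ≤ Ls m := by simp only [hLs_def]; omega
    have hL₀ : L₀ ≤ Ls m := by simp only [hLs_def]; omega
    have hev : Even (Ls m) := by simp only [hLs_def]; exact even_two_mul _
    have h4 := hΦfs (Ls m) hL3 hL₀ hev
    have hLpos : (0 : ℝ) < ((Ls m : ℕ) : ℝ) ^ 2 := by positivity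
    rw [mul_div_assoc', ← sub_div, le_div_iff₀ hLpos]
    calc 4 * ρs * (((Ls m : ℕ) : ℝ) ^ 2) = 4 * (ρs * ((Ls m : ℕ) : ℝ) ^ 2) := by ring
      _ ≤ _ := h4
  -- compactness: a torus-limit point along a subsequence of `Ls`
  have hN : ∀ L, IsNParticle (rectN (1 - δ) L) (Φ L) := fun L => ((mem_szSector_iff _ _ _).1 (hΦ L).1).1
  obtain ⟨φ, hφ, ω, hω, -, -⟩ :=
    InfVolFermionState.exists_isTorusLimitOf_subseq_of_isNParticle Φ hN hLs fun j => hΦ1 (Ls j)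
  have hLφ : Tendsto (Ls ∘ φ) atTop atTop := hLs.comp hφ.tendsto_atTop
  -- convergence of the energy per site (Ruelle)
  have hE : Tendsto (fun j => (star (Φ (Ls (φ j))) ⬝ᵥ (hubbardTorus 2 (Ls (φ j)) 1 U *ᵥ Φ (Ls (φ j)))).re /
      (((Ls (φ j)) : ℕ) : ℝ) ^ 2) atTop (𝓝 (energyDensity2D 1 U (1 - δ))) := by
    have hlim := (tendsto_energyDensity2D_torus 1 hU hn0 hn2).comp hLφ
    refine hlim.congr' (Eventually.of_forall fun j => ?_)
    simp only [Function.comp_apply]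
    rw [re_rayleigh_hubbardTorus_of_isGroundStateInSector_rectN 1 U (Ls (φ j)) hn0 hn2.le (hΦH _) (hΦ1 _)]
    rfl
  -- convergence of the double occupancy per site (the torus average of the local word IS the total per site)
  have hD : Tendsto (fun j => (star (Φ (Ls (φ j))) ⬝ᵥ
      ((∑ x : FermionTorus 2 (Ls (φ j)), numberOp x 0 * numberOp x 1) *ᵥ Φ (Ls (φ j)))).re /
      (((Ls (φ j)) : ℕ) : ℝ) ^ 2) atTop
      (𝓝 (ω.expect ({0} : Finset (Site 2)) (nAt 0 (mem_singleton_self 0) 0 * nAt 0 (mem_singleton_self 0) 1)).re) := by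
    have hlim := (Complex.continuous_re.tendsto _).comp
      (hω ({0} : Finset (Site 2)) (nAt 0 (mem_singleton_self 0) 0 * nAt 0 (mem_singleton_self 0) 1))
    refine hlim.congr' ?_
    filter_upwards [hLφ.eventually_ge_atTop 1] with j hj
    haveI : NeZero (Ls (φ j)) := ⟨by simp only [hLs_def]; omega⟩
    rw [Function.comp_apply, Function.comp_apply, torusAvgExpect_docc, ← Complex.ofReal_natCast, ← Complex.ofReal_pow,
      ← Complex.ofReal_inv, Complex.re_ofReal_mul, inv_mul_eq_div]
    rfl
  -- hence ⟨−T⟩/L² → U·docc(ω) − e(U, n) along the subsequence, and 4ρ_s sits below every term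
  have hT := (hD.const_mul U).sub hE
  have h4 : 4 * ρs ≤ U * (ω.expect ({0} : Finset (Site 2)) (nAt 0 (mem_singleton_self 0) 0 * nAt 0 (mem_singleton_self 0) 1)).re -
      energyDensity2D 1 U (1 - δ) :=
    ge_of_tendsto' hT fun j => hfin (φ j)
  -- the dictionary and the hypothesis at the limit state
  have hk := kineticDensity_eq_energyDensityTT'_sub_mul_docc hU hn0 hn2 ω (Ls ∘ φ) Φ hLφ (fun j => hΦ _) (fun j => hΦ1 _) hω
  have hXω := hX ω (Ls ∘ φ) Φ hLφ (fun j => hΦ _) (fun j => hΦ1 _) hω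
  rw [hk, energyDensityTT'_zero] at hXω
  linarith

/-! ## §4 M3′ wrapper (`U = 8`, `n = 7/8`, `t′ = 0`) -/

/-- **T6 at the M3′ point**: if `−k(ω) ≤ X` for every torus limit `ω` of unit `(rectN (7/8) L, S^z = 0)`-sector ground states of
`hubbardTorusTT' L 1 0 8`, then every flux stiffness of the `(N_L, 0)` sectors of `hubbardTorus 2 L 1 8` at `δ = 1/8` satisfies
`ρ_s ≤ X/4` (tree units; HVR `½(D_s^x + D_s^y) ≤ X/8`). The hypothesis is exactly the conclusion shape of the cell's kinetic rows
(`m3_tp0_kineticDensity_ge_derived`: X = 15746217922602363028802719/2⁸³ ⇒ `OBS.rhosK.tp0.TLderived` unconditional;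
`m3_tp0_kineticDensity_ge_chord_r354_r426`: X = 906213886029816052260099/2⁷⁹ ⇒ p2's chord row again; a future `kinlo` certificate ⇒ its f-sum row).
[cite: HazraVermaRanderia2019, eqs. (2)–(4)] -/
theorem m3_tp0_fluxStiffness_le_quarter_of_forall_negKinetic_le {X : ℝ}
    (hX : ∀ (ω : InfVolFermionState 2) (Ls : ℕ → ℕ) (ψ : ∀ L, Fock (Orb (FermionTorus 2 L))),
      Tendsto Ls atTop atTop →
      (∀ j, IsGroundStateInSector (hubbardTorusTT' (Ls j) 1 0 8) (rectN (7/8) (Ls j)) 0 (ψ (Ls j))) →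
      (∀ j, star (ψ (Ls j)) ⬝ᵥ ψ (Ls j) = 1) → ω.IsTorusLimitOf ψ Ls →
      -(∑ i : Fin 2, -(1 : ℝ) * ∑ σ : Fin 2,
          ((ω.expect {0, 0 + unitVec i}
              ((cAt 0 (mem_insert_self _ _) σ)ᴴ * cAt (0 + unitVec i) (mem_insert_of_mem (mem_singleton_self _)) σ)).re +
            (ω.expect {0, 0 + unitVec i}
              ((cAt (0 + unitVec i) (mem_insert_of_mem (mem_singleton_self _)) σ)ᴴ * cAt 0 (mem_insert_self _ _) σ)).re)) ≤ X) :
    ∀ (ρs θ₀ : ℝ), 0 < ρs → 0 < θ₀ → ∀ L₀ : ℕ,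
      (∀ (L : ℕ) [NeZero L], L₀ ≤ L → Even L →
        ∀ θ : ℝ, |θ| ≤ θ₀ → ρs * θ ^ 2 ≤ fluxEnergy L 8 (1 / 8) θ - fluxEnergy L 8 (1 / 8) 0) →
      ρs ≤ X / 4 := by
  have h78 : (1 - 1 / 8 : ℝ) = 7 / 8 := by norm_num
  refine fluxStiffness_le_quarter_of_forall_torusLimit_negKinetic_le (U := 8) (δ := 1 / 8) (by norm_num) (by norm_num)
    (by norm_num) fun ω Ls ψ hLs hψ hψ1 hω => hX ω Ls ψ hLs (fun j => ?_) hψ1 hω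
  have h := hψ j
  rwa [h78] at h

end Summit.Ventures.CertifiedManyBodySolver.Observables

end
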